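import Summits.ValiantsHypothesis.ValiantsHypothesis.Theses.SchenstedIndex

/-!
# ValiantsHypothesis / SchenstedIndex — item `Assembly` (stmt-ValiantsHypothesis-16008), closed

The assembly item of route `SchenstedIndex` reads `OneFactorisationBandLimit → PowTraceCertificate →
ValiantsHypothesis`, which is exactly the route's crux-only deciding theorem `Theses.SchenstedIndex.closes`
(2026-08-16 cone repair: the bookkeeping fact "VP ⇒ quasi-polynomial power-trace representations" is the
PROVED `GeneratorObstructions` item stmt-11661, discharged inside `closes` by `Theorems.perPowTraceQP_proof`).
So the item is proved by `closes` itself (as the route's grounder recorded on the item, 2026-08-17).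
HONEST FRAMING: bookkeeping; both hypotheses are OPEN cruxes; nothing here is progress on `VP ≠ VNP`.
-/

-- layout Summits/ValiantsHypothesis/ValiantsHypothesis forces the duplicated namespace component
set_option linter.dupNamespace false

namespace Summit.ValiantsHypothesis.ValiantsHypothesis.Theorems.SchenstedIndex

/-- **Item `Assembly` (stmt-ValiantsHypothesis-16008):** `OneFactorisationBandLimit → PowTraceCertificate →
ValiantsHypothesis` — the route's deciding theorem `closes`. [folklore] -/
theorem assembly_proof : Theses.SchenstedIndex.Assembly := by
  unfold Theses.SchenstedIndex.Assembly
  exact fun hK hC => Theses.SchenstedIndex.closes hK hC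

end Summit.ValiantsHypothesis.ValiantsHypothesis.Theorems.SchenstedIndex
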